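import Literature.MathematicalPhysics.QuantumFieldTheory.Balaban1983to89.B8SectGH

/-!
# `Balaban1983to89.B8Ineq145` — the equality (1.145) of B8 Prop. 7, bond class by bond class

CITATION HEADER (lean-in-tree rule 2026-08-18).  Kernel certificate written by the B08 owner lineage
(`b2b-balaban-b08`, generation 9) of the audit cell `pub-balaban` in answer to the adversarial census row
**G-adv8-16** (GAPS.md, `b2b-balaban-adv8-g17`, 2026-08-18) against

* **B8** = T. Bałaban, *Spaces of regular gauge field configurations on a lattice and gauge fixing
  conditions*, Commun. Math. Phys. **99** (1985) 75–102 [cite key `Balaban1985RegularSpaces`;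
  printed page = PDF page + 74; renders read as images: `1985-cmp99-regular-spaces-gauge-fixing-p005/p007/
  p008/p026-x2.png` = printed pp. 79, 81, 82, 100], used together with
* **B7** = T. Bałaban, *Averaging operations for lattice gauge theories*, Commun. Math. Phys. **98** (1985)
  17–51 [cite key `Balaban1985Averaging`; printed page = PDF page + 16; renders `1985-cmp98-averaging-p014/
  p015/p016/p017/p026-x2.png` = printed pp. 30–33, 42].

Nothing in this module is cited FROM the manuscripts as a fact: every `theorem` below is kernel-proved from
the displayed algebraic laws, and the printed formulas enter only as the DEFINITIONS of those laws (fields of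
`LevelData`) — the ABSOLUTE RULE of the cell (no internally-minted statement enters as a cited fact; the
manuscript under audit is not citable for its own disputed step).

## The printed texts (verbatim, from the renders)

* B8 p. 100, before and in Prop. 7: «The Proposition 4 from [3] gives also `|Q_j(U₀, ηA)| < 2α₂ on Ω_j^{(j)}`
  (1.143).  Let us take a gauge transformation `u` satisfying the conditions (1.29) and such that the
  configuration `U′ = (U₁U₀)^u U₀^{-1}` satisfies the axial gauge conditions (1.19).  This gauge transformation
  is determined uniquely.  The above bounds imply the following **Proposition 7.** If the configurations
  `U₀, A` satisfy (1.139), (1.140), then for `α₀, α₂` sufficiently small we have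
  `U′U₀ = (U₁U₀)^u ∈ 𝔄_k({Ω_j}, α₀ + 3α₂) ∩ Ax_k(𝔅_k, U₀)` (1.144),
  `|(U′U₀)‾^j − Ū₀^j| = |exp iQ_j(U₀, ηA) − 1| < 2α₂ on Ω_j^{(j)}` (1.145).  This theorem complements Theorem 2.
  The gauge transformations constructed there establish not only a mapping of the space (1.33)–(1.35) into
  the space (1.36)–(1.39), but a kind of isomorphism also, in the sense that the inverse mapping transforms the
  second space, defined by some constant `α₂` instead of `B₁(α₀ + α₁)`, into the first one with properly
  chosen `α₀, α₁`.»
* B8 p. 79, (1.19)–(1.20): «for `x₀ ∈ B^j(x_j)`, `x_j ∈ Λ_j`, `1 ≤ j ≤ k`, we define a sequence of points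
  `x₀, x₁, …, x_{j-1}, x_j` by the conditions `x_n ∈ B(x_{n+1})`, `n = 0, 1, …, j−1`, and we put
  `(R̄^n_{0,x_{n+1}}Ũ′^n)(Γ_{x_{n+1},x_n}) = Π_{b ⊂ Γ_{x_{n+1},x_n}} R(Ū^n_0(Γ_{x_{n+1},b₋}))Ũ′^n_b = 1` (1.19).
  Let us recall that the average `Ũ′^n` was defined in [3] as `Ũ′^n = (U′U₀)‾^n (Ū₀^n)^{-1}` (1.20)»; and, same
  page (proof of Lemma 1): «The conditions `(R₀V′)(Γ_{y,x}) = 1, x ∈ B(y)`, imply `V′_b = 1` for `b ⊂ Γ_{y,x}`».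
* B8 p. 81, (1.29)–(1.30) and the paragraph after them: «`(R̄₀u^j)(y) = 1` for `y ∈ Λ_j`, `j = 0, 1, …, k`
  (1.29) … The configurations `U′` satisfy the equations `Ũ′^j = V(Ū₀^j)^{-1}` on `Λ_j`, hence `U₁` satisfies
  `(Ũ₁^{u j})_b = u(b₋)(Ũ₁^j)_b R̄^j_{0,b} u^{-1}(b₊) = V_b(Ū₀^j)_b^{-1}, b ∈ Λ_j` (1.30) … In [3] we have
  determined the gauge transformation `u` in terms of the configuration `U₁`.  We refer the reader especially
  to the formulas (87), (99), (97), and (105) of that paper.  If both end-points `b₋, b₊` of a bond `b` belong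
  to `Λ_j`, then the expression on the left-hand side of (1.30) is equal to `(Ū₁^j)_b` by (92) of [3].  If a
  bond `b` crosses the boundary of `Λ_j`, then one of the end-points belongs to `Λ_j`, e.g. `b₊ ∈ Λ_j`, and
  another to `Λ_{j-1}`, `b₋ ∈ Λ_{j-1}`.  In this case the formulas (97), (99), and (87) of [3] imply
  `(Ũ₁^{u j})_b = \overline{(R̄^{j-1}_{0,b₋}Ū₁^{j-1})} (Ū₁^j)_b = V_b(Ū₀^j)_b^{-1}`, where by the formula (105)
  of [3] `\overline{(R̄^{j-1}_{0,b₋}Ū₁^{j-1})} = exp[i Σ_{x ∈ B(b₋)} L^{-d} (1/i) log(R̄^{j-1}_{0,b₋}Ū₁^{j-1})(Γ_{b₋,x})]`»;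
  p. 82 (1.31) displays exactly these two lines («All sites of the contours `Γ_{b₋,x}` belong to `Λ_{j-1}`»),
  and (1.35)/(1.37) of Theorem 2 (p. 82) carry the same structure forward with the constant `|B| < 2dLα₁`
  (1.37).  Note the printed «e.g.»: the mirrored orientation `b₋ ∈ Λ_j, b₊ ∈ Λ_{j-1}` is left to the reader.
* B7 p. 42, (159)–(163): «`(Ũ′)^k_b = v_k(b₋)(\bar\bar U′^k)_b R̄^k_{0,b} v_k^{-1}(b₊), b ⊂ Ω^{(k)}` (159), where
  `v_k(x) = (\overline{R_{0,x}U′})(\overline{R̄^1_{0,x}\bar\bar U′^1})·…·(\overline{R̄^{k-1}_{0,x}\bar\bar U′^{k-1}}),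
  x ∈ Ω^{(k)}` (160).  From Proposition 4, and especially from (131), we get `|(1/i) log \bar\bar U′^j| =
  |Q_j(U₀, ηA′)| < 2α₁L^jη` (161), hence `|(1/i) log(\overline{R̄^j_{0,x}\bar\bar U′^j})| = |Σ_{x_j ∈ B(x)} L^{-d}
  (1/i) log(R̄^j_{0,x}\bar\bar U′^j)(Γ_{x,x_j})| < 8α₁dL^{j+1}η e^{2α₁dL^{j+1}η} < O(1)α₁L^{j+1}η,
  j = 0, 1, …, k−1` (162)»; B7 pp. 31–33: (84) `(R̄₀u^j)(x_j) = u(x_j)\overline{(R_{0,x_j}U₁)}^{(j)}`,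
  (97) `(Ũ₁^j)_b = v_j(b₋)(\bar\bar U₁^j)_b R̄^j_{0,b} v_j^{-1}(b₊)`, (99) `\overline{(R_{0,x}U₁)}^{(j)} = v_j(x)`,
  (100) `v_{j+1}(y) = v_j(y)\overline{(R̄^j_{0,y}\bar\bar U₁^j)}`, (105) the block exp-mean-log formula for
  `\overline{(R̄^j_{0,x_{j+1}}\bar\bar U₁^j)}`.
* B8 p. 100, (1.139)–(1.140): the hypotheses of Sect. G are `U₀ ∈ 𝔄_k({Ω_j}, α₀)` and `L^jη|A|, (L^jη)²|∇^{U₀}_η A|,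
  (L^jη)³|D*_{U₀}D^η_{U₀}A| < α₂ on Ω_j` — no gauge condition on `A`.

Here `R̄^j_{0,b} w = Ū^j_{0,b} w (Ū^j_{0,b})^{-1}` (the operation `R` of B7 (11)), written `rOp` below, and B8's
`Ū₁^j`, `Q_j(U₀,ηA) = (1/i) log Ū₁^j` are B7's `\bar\bar U₁^j`, `Q_j` (B8 p. 81 «by (92) of [3]»; B7 Prop. 4).

## THE LOCATED GAP G-adv8-16 and the owner's adjudication (this module is its kernel part)

(1.145) asserts an EQUALITY `|Ũ′^j_b − 1| = |exp iQ_{j,b} − 1|` for all `j`-bonds of `Ω_j^{(j)}`.  Sorting the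
bonds (`Ũ′^j = Ũ₁^{u j}` by (1.20)/(1.30)):

* (c) INTERIOR bonds, `b₋, b₊ ∈ Λ_j`: `Ũ′^j_b = (Ū₁^j)_b = exp iQ_{j,b}` exactly — the paper's own sentence
  «If both end-points … belong to `Λ_j` …» (p. 81); kernel-checked below as `LevelData.interior` from the laws
  (1.30), (97), (84)+(99), (1.29).  Here (1.145) is right, equality and bound.
* (b) CROSSING bonds, `b₋ ∈ Λ_{j-1}`, `b₊ ∈ Λ_j` (among the bonds «`b ∈ Λ_j`» of (1.30), p. 81): `Ũ′^j_b = F(b₋)·exp iQ_{j,b}`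
  with `F(y) = \overline{(R̄^{j-1}_{0,y}\bar\bar U₁^{j-1})}` — the paper's own sentence «If a bond b crosses the
  boundary of `Λ_j` …» (p. 81) = second line of (1.31); kernel-checked below as `LevelData.crossing` (and the
  mirrored orientation `b₋ ∈ Λ_j, b₊ ∈ Λ_{j-1}`, the printed «e.g.», as `LevelData.crossing_mirrored`).  Hence `Ũ′^j_b = exp iQ_{j,b} ↔ F(b₋) = 1`
  (`LevelData.eq145_iff`): the EQUALITY of (1.145) fails whenever the block factor is non-trivial, and the bound
  that the displayed laws give is `|Ũ′^j_b − 1| ≤ |F(b₋) − 1| + |exp iQ_{j,b} − 1|` (`LevelData.dist_crossing_le`),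
  i.e. `< 8dLα₂e^{2dLα₂} + 2α₂` by B7 (162) [with B7's `α₁L^jη` read as B8's `α₂`, the input (161) being (1.143)]
  — or `≤ (1 + κ·d(L−1))·2α₂` (`= 2dLα₂ − 2(d−1)α₂ ≤ 2dLα₂` for `κ = 1`) by the elementary staircase count
  (`dist_blockFactor_le`: a `κ`-Lipschitz block average of `≤ d(L−1)` transporters each within `2α₂` of `1`),
  the mirror image of the paper's own forward constant `2dLα₁` in (1.37).  NOT `2α₂`: in the flat abelian configuration `U₀ ≡ 1`, `A_b ≡ aX`
  (legitimate under (1.139)–(1.140), which put no gauge condition on `A`) every logarithm adds up, the block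
  factor is `exp(i·(d(L−1)/2)·L^{j-1}ηa·X)` (mean staircase length `d(L−1)/2`, `stairMean_eq` below) and on a
  top-level crossing bond `|Ũ′^k_b − 1| = 2|sin(((1 + d(L−1)/(2L))·L^kηa)/2)|`; for `d = 4`, `L = 3`,
  `L^kηa = (27/28)α₂` this is `2 sin((9/8)α₂) > 2α₂` (`flat_witness_exceeds`, all `0 < α₂ ≤ 7/10`), while
  (1.140) (`L^kη|A| = (27/28)α₂ < α₂`, derivatives zero) and (1.143) hold.  So on crossing bonds even the
  INEQUALITY of (1.145) fails as printed for `d(L−1) > 2L` (ratio `(3 − 2/L)/2 → 3/2` in `d = 4`); it holds with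
  any of the constants above.  [The adversarial row's witness `A = a·e₁` exhibits the failure of the EQUALITY on
  crossing bonds of direction `μ ≠ 1` (`Q_{j,b} = 0`, `F ≠ 1`); with a single component the inequality survives,
  ratio `(1 + (L−1)/(2L)) < 2`.]
* (a) TREE bonds of (1.19) inside `Ω_{j+1}^{(j)}`: the axial gauge (1.144) forces `Ũ′^j_b = 1` there (p. 79, the
  sentence quoted above; kernel-checked in the abstract as `tree_bonds_trivial`: prefix-closed contour products all
  equal to `1` force every factor to be `1`), so the EQUALITY of (1.145) fails on every tree bond with
  `Q_{j,b} ≠ 0` (`eq145_fails_of_trivial`), the inequality being trivially true.  CONFIRMED as stated in G-adv8-16.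
* (d) the remaining `j`-bonds of `Ω_{j+1}^{(j)}` (non-tree): no law of pp. 81–82 produces (1.145) there; Theorem 2
  consumes (1.35) on `Λ_j` only, so nothing downstream reads them.

VERDICT (owner, gen 9): G-adv8-16 **CONFIRMED, constants-only**.  Repaired reading of (1.145): «`= |exp iQ_j − 1|
< 2α₂` for `b ⊂ Λ_j`; `|Ũ′^j_b − 1| < C(d,L)·α₂` on the bonds of `Λ_j` crossing `∂Λ_j`
(`C = 2 + 8dLe^{2dLc}` via B7 (162), or `2dL` by the count); no claim on `Ω_{j+1}^{(j)}`».  Consequently Prop. 7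
feeds Theorem 2 through (1.35) with `α₁ = C(d,L)α₂` instead of `2α₂` (`Prop7RepairedC`,
`thm2_after_prop7RepairedC` below): B11 p. 299's `O(1)` (depending on `d, L` only) absorbs it; no statement of
B8/B11/B12 changes shape.

## What is kernel-proved here (abstract carriers; `sorry`-free)

§1 `LevelData` = the level-`j` data of B8 Sect. B/G on an abstract site type `S`, bond type `B`, group `G`, with the
displayed laws (1.30), (97)/(159), (84)+(99) at levels `j` and `j−1`, (100) as fields; theorems `interior`,
`crossing`, `crossing_mirrored`, `eq145_iff`.  §2 bi-invariant (pseudo)metric bookkeeping: `dist (rOp g w) 1 =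
dist w 1`, `dist (x*y) 1 ≤ dist x 1 + dist y 1`, list products, `dist (X*Y⁻¹) 1 = dist X Y` (= the left member of
(1.145) via (1.20)), `dist_crossing_le`, `dist_crossing_mirrored_le`.  §3 the block-factor bound from a
`κ`-Lipschitz average of staircase products (`dist_blockFactor_le`) and the constants `const_count_le_2dL`,
`const_B7_162_le`.  §4 tree bonds: `tree_bonds_trivial`, `eq145_fails_of_trivial`.  §5 the flat abelian witness
numbers: `stairMean_eq` (mean of `Σ_μ x_μ` over `{0,…,L−1}^d` is `d(L−1)/2`, by the reflection `x ↦ L−1−x`),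
`flatRatio`, `two_lt_flatRatio_iff`, `flatRatio_four`, `flat_witness_exceeds`.  §6 `Prop7RepairedC` (Prop. 7 with
(1.145) ↦ (1.35) at constant `C·α₂`, over pv17's `B8SectGH.GFData3` so that the hypothesis is the printed (1.140)),
`prop7RepairedC_of_printedR` (the typed printed form implies the repaired one for `C ≥ 2`: the repair WEAKENS),
`thm2_after_prop7RepairedC` (Theorem 2 applies to `U′` with `α₁ = Cα₂`; smallness `α₀ + (3 + C)α₂ ≤ c`).

## What is NOT claimed

No lattice model of the averaging operations is built here (the flat-abelian numbers of §5 are the hand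
computation's arithmetic skeleton under the stated dictionary, not a formalisation of B7 (15)/(89)–(91)/(105));
the typed printed statements `B8.Prop7Printed`, `B8SectGH.Prop7PrintedR` and their consumers in `DagBinding` are
left verbatim (other lineages' files; hand-over flags in the census); nothing here is progress on the summit
`Summit.QuantumFields` — the value is a located objection adjudicated with a kernel certificate.
-/

namespace Literature.MathematicalPhysics.QuantumFieldTheory.Balaban1983to89.B8Ineq145

/-! ## §1  The group algebra of (1.30)/(97)/(84)/(99)/(100)/(1.29) -/

section Algebra

variable {S B G : Type*} [Group G]

/-- The operation `R(g) w = g w g⁻¹` of B7 (11) (so `R̄^j_{0,b} w = Ū^j_{0,b} w (Ū^j_{0,b})⁻¹` in (97), (1.30)).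
[cite: Balaban1985Averaging, (11) p. 19] -/
def rOp (g w : G) : G := g * w * g⁻¹

/-- `R(g) 1 = 1`. [folklore] -/
@[simp] theorem rOp_one (g : G) : rOp g 1 = 1 := by simp [rOp]

/-- `R(g)` is multiplicative. [folklore] -/
theorem rOp_mul (g w w' : G) : rOp g (w * w') = rOp g w * rOp g w' := by
  simp [rOp, mul_assoc]

/-- `R(g)` commutes with inversion. [folklore] -/
theorem rOp_inv (g w : G) : rOp g w⁻¹ = (rOp g w)⁻¹ := by
  simp [rOp, mul_assoc]

/-- `R(g) w = 1 ↔ w = 1`. [folklore] -/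
theorem rOp_eq_one {g w : G} : rOp g w = 1 ↔ w = 1 := by
  constructor
  · intro h
    have h' : g⁻¹ * (g * w * g⁻¹) * g = g⁻¹ * 1 * g := by rw [show g * w * g⁻¹ = 1 from h]
    simpa [mul_assoc] using h'
  · rintro rfl
    simp

/-- The level-`j` data of B8 Sect. B (pp. 81–82) / Sect. G around a family `B` of `j`-bonds with endpoints in a
site type `S` (the `j`-lattice), over the gauge group `G`, together with the DISPLAYED LAWS as hypotheses:
`Uu` = `Ũ₁^{u j} = Ũ′^j` ((1.20), (1.30)), `Ut` = `Ũ₁^j` (B7 (87)–(88)), `W` = `Ū₁^j = \bar\bar U₁^j = exp iQ_j(U₀,ηA)`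
(B7 Prop. 4), `r` = `Ū₀^j`, `u` = the gauge transformation of Prop. 7, `Ru`/`RuPrev` = `R̄₀u^j`/`R̄₀u^{j-1}` at
`j`-lattice sites (B7 (79)–(80)), `v`/`vPrev` = `v_j`/`v_{j-1}` (B7 (97)), `F` = `\overline{(R̄^{j-1}_{0,·}\bar\bar
U₁^{j-1})}` (B7 (100)/(105)).  Laws: `h130` = B8 (1.30); `h97` = B7 (97) (= (159)); `h84`, `h84prev` = B7 (84) combined
with (99) at levels `j` and `j−1`; `h100` = B7 (100) with `j−1` in place of `j`.  Condition (1.29) of B8 (`R̄₀u^j = 1`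
on `Λ_j^{(j)}`) is NOT a field: it enters the theorems as a hypothesis on the relevant endpoints, so that the same
structure serves interior, crossing and mirrored bonds.
[cite: Balaban1985RegularSpaces, (1.29)–(1.31) pp. 81–82] -/
structure LevelData (S B G : Type*) [Group G] where
  /-- `b₋` -/
  src : B → S
  /-- `b₊` -/
  tgt : B → S
  /-- `Ū₀^j_b` -/
  r : B → G
  /-- `(Ū₁^j)_b = exp iQ_j(U₀,ηA)_b` -/
  W : B → G
  /-- `(Ũ₁^j)_b` -/
  Ut : B → G
  /-- `(Ũ₁^{u j})_b = Ũ′^j_b` -/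
  Uu : B → G
  /-- the gauge transformation `u` at `j`-lattice sites -/
  u : S → G
  /-- `(R̄₀u^j)(y)` -/
  Ru : S → G
  /-- `v_j(y)` -/
  v : S → G
  /-- `(R̄₀u^{j-1})(y)` at `j`-lattice sites -/
  RuPrev : S → G
  /-- `v_{j-1}(y)` at `j`-lattice sites -/
  vPrev : S → G
  /-- the block factor `\overline{(R̄^{j-1}_{0,y}\bar\bar U₁^{j-1})}` -/
  F : S → G
  /-- B8 (1.30). -/
  h130 : ∀ b, Uu b = u (src b) * Ut b * rOp (r b) (u (tgt b))⁻¹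
  /-- B7 (97) = (159). -/
  h97 : ∀ b, Ut b = v (src b) * W b * rOp (r b) (v (tgt b))⁻¹
  /-- B7 (84) with (99), level `j`. -/
  h84 : ∀ y, Ru y = u y * v y
  /-- B7 (84) with (99), level `j − 1`. -/
  h84prev : ∀ y, RuPrev y = u y * vPrev y
  /-- B7 (100) (with `j − 1` in place of `j`). -/
  h100 : ∀ y, v y = vPrev y * F y

namespace LevelData

variable (X : LevelData S B G)

/-- (1.29) at a site where `R̄₀u^j = 1` gives `u·v_j = 1` («`u(b₊) = v_j⁻¹(b₊)`», p. 81). [folklore] -/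
theorem u_mul_v_eq_one {y : S} (h : X.Ru y = 1) : X.u y * X.v y = 1 := by
  rw [← X.h84]; exact h

/-- (1.29) at level `j−1` gives `u·v_{j-1} = 1` («`u(b₋) = v_{j-1}⁻¹(b₋)`», p. 81). [folklore] -/
theorem u_mul_vPrev_eq_one {y : S} (h : X.RuPrev y = 1) : X.u y * X.vPrev y = 1 := by
  rw [← X.h84prev]; exact h

/-- At a site with `R̄₀u^{j-1} = 1` one has `u·v_j = F` (this is «using (97), (100)» of p. 81). [folklore] -/
theorem u_mul_v_eq_F {y : S} (h : X.RuPrev y = 1) : X.u y * X.v y = X.F y := by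
  rw [X.h100, ← mul_assoc, X.u_mul_vPrev_eq_one h, one_mul]

/-- The master identity behind (1.30)+(97): `Ũ′^j_b = (u v_j)(b₋) · Ū₁^j_b · R̄^j_{0,b}((u v_j)(b₊))⁻¹`.
[folklore] -/
theorem Uu_eq (b : B) :
    X.Uu b = (X.u (X.src b) * X.v (X.src b)) * X.W b *
      rOp (X.r b) (X.u (X.tgt b) * X.v (X.tgt b))⁻¹ := by
  rw [X.h130, X.h97]
  simp only [rOp, mul_inv_rev]
  group

/-- (c) INTERIOR bonds (`b₋, b₊ ∈ Λ_j`, i.e. (1.29) at both endpoints): `Ũ′^j_b = Ū₁^j_b = exp iQ_{j,b}` —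
p. 81 «If both end-points b₋, b₊ of a bond b belong to Λ_j, then the expression on the left-hand side of (1.30)
is equal to (Ū₁^j)_b»; here (1.145) holds with equality.
[cite: Balaban1985RegularSpaces, (1.31) line 1, p. 82] -/
theorem interior {b : B} (hs : X.Ru (X.src b) = 1) (ht : X.Ru (X.tgt b) = 1) : X.Uu b = X.W b := by
  rw [X.Uu_eq, X.u_mul_v_eq_one hs, X.u_mul_v_eq_one ht]
  simp

/-- (b) CROSSING bonds (`b₋ ∈ Λ_{j-1}`, `b₊ ∈ Λ_j`): `Ũ′^j_b = F(b₋) · Ū₁^j_b` — p. 81 «If a bond b crosses the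
boundary of Λ_j … the formulas (97), (99), and (87) of [3] imply …» (= (1.31) line 2).
[cite: Balaban1985RegularSpaces, (1.31) line 2, p. 82] -/
theorem crossing {b : B} (hs : X.RuPrev (X.src b) = 1) (ht : X.Ru (X.tgt b) = 1) :
    X.Uu b = X.F (X.src b) * X.W b := by
  rw [X.Uu_eq, X.u_mul_v_eq_F hs, X.u_mul_v_eq_one ht]
  simp

/-- (b′) the MIRRORED crossing bonds (`b₋ ∈ Λ_j`, `b₊ ∈ Λ_{j-1}`; the printed «e.g.» case left to the reader):
`Ũ′^j_b = Ū₁^j_b · R̄^j_{0,b}(F(b₊))⁻¹`. [folklore] -/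
theorem crossing_mirrored {b : B} (hs : X.Ru (X.src b) = 1) (ht : X.RuPrev (X.tgt b) = 1) :
    X.Uu b = X.W b * rOp (X.r b) (X.F (X.tgt b))⁻¹ := by
  rw [X.Uu_eq, X.u_mul_v_eq_one hs, X.u_mul_v_eq_F ht]
  simp

/-- On a crossing bond the EQUALITY of (1.145), `Ũ′^j_b = exp iQ_{j,b}`, holds iff the block factor is trivial,
`F(b₋) = 1`. [folklore] -/
theorem eq145_iff {b : B} (hs : X.RuPrev (X.src b) = 1) (ht : X.Ru (X.tgt b) = 1) :
    X.Uu b = X.W b ↔ X.F (X.src b) = 1 := by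
  rw [X.crossing hs ht]
  constructor
  · intro h
    simpa using congrArg (· * (X.W b)⁻¹) h
  · rintro h
    simp [h]

/-- Mirrored version of `eq145_iff`. [folklore] -/
theorem eq145_iff_mirrored {b : B} (hs : X.Ru (X.src b) = 1) (ht : X.RuPrev (X.tgt b) = 1) :
    X.Uu b = X.W b ↔ X.F (X.tgt b) = 1 := by
  rw [X.crossing_mirrored hs ht]
  constructor
  · intro h
    have h' : rOp (X.r b) (X.F (X.tgt b))⁻¹ = 1 := by
      simpa using congrArg ((X.W b)⁻¹ * ·) h
    rw [rOp_inv, inv_eq_one, rOp_eq_one] at h'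
    exact h'
  · rintro h
    simp [h]

/-- Set form of (c)+(b): with (1.29) on `Λ_j` at level `j` and on `Λ_{j-1}` at level `j−1` (the gauge `u` fixes
`R̄₀u^{j-1} = 1` on `Λ_{j-1}^{(j-1)} ⊇` the `j`-sites of `Λ_{j-1}`), the two displayed lines of (1.31). [folklore] -/
theorem lines_131 (Λj ΛjPrev : Set S) (h129 : ∀ y ∈ Λj, X.Ru y = 1)
    (h129prev : ∀ y ∈ ΛjPrev, X.RuPrev y = 1) (b : B) :
    (X.src b ∈ Λj → X.tgt b ∈ Λj → X.Uu b = X.W b) ∧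
    (X.src b ∈ ΛjPrev → X.tgt b ∈ Λj → X.Uu b = X.F (X.src b) * X.W b) ∧
    (X.src b ∈ Λj → X.tgt b ∈ ΛjPrev → X.Uu b = X.W b * rOp (X.r b) (X.F (X.tgt b))⁻¹) :=
  ⟨fun hs ht => X.interior (h129 _ hs) (h129 _ ht),
   fun hs ht => X.crossing (h129prev _ hs) (h129 _ ht),
   fun hs ht => X.crossing_mirrored (h129 _ hs) (h129prev _ ht)⟩

end LevelData

end Algebra

/-! ## §2  Bi-invariant metric bookkeeping (`|·|` = operator norm distance on `G ⊂ U(N)`) -/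

section Metric

variable {S B G : Type*} [Group G] [PseudoMetricSpace G] [IsIsometricSMul G G] [IsIsometricSMul Gᵐᵒᵖ G]

/-- `|R(g)w − 1| = |w − 1|` for a bi-invariant distance. [folklore] -/
theorem dist_rOp_one (g w : G) : dist (rOp g w) 1 = dist w 1 := by
  have h : dist (g * w * g⁻¹) (g * 1 * g⁻¹) = dist w 1 := by rw [dist_mul_right, dist_mul_left]
  simpa [rOp] using h

omit [IsIsometricSMul Gᵐᵒᵖ G] in
/-- `|xy − 1| ≤ |x − 1| + |y − 1|`. [folklore] -/
theorem dist_mul_one_le (x y : G) : dist (x * y) 1 ≤ dist x 1 + dist y 1 := by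
  calc dist (x * y) 1 ≤ dist (x * y) (x * 1) + dist (x * 1) 1 := dist_triangle _ _ _
    _ = dist y 1 + dist x 1 := by rw [dist_mul_left, mul_one]
    _ = dist x 1 + dist y 1 := add_comm _ _

/-- `|x⁻¹ − 1| = |x − 1|`. [folklore] -/
theorem dist_inv_one (x : G) : dist x⁻¹ 1 = dist x 1 := by
  simpa using dist_inv_inv x (1 : G)

omit [IsIsometricSMul Gᵐᵒᵖ G] in
/-- `|w₁⋯wₙ − 1| ≤ Σ |wᵢ − 1|` (transporters along a contour). [folklore] -/
theorem dist_list_prod_one_le (l : List G) : dist l.prod 1 ≤ (l.map fun w => dist w 1).sum := by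
  induction l with
  | nil => simp
  | cons w l ih =>
    simp only [List.prod_cons, List.map_cons, List.sum_cons]
    exact (dist_mul_one_le w l.prod).trans (by linarith)

omit [IsIsometricSMul G G] [IsIsometricSMul Gᵐᵒᵖ G] in
/-- Each factor within `ρ` of `1`: `Σ |wᵢ − 1| ≤ length · ρ`. [folklore] -/
theorem sum_dist_le_length_mul (l : List G) {ρ : ℝ} (h : ∀ w ∈ l, dist w 1 ≤ ρ) :
    (l.map fun w => dist w 1).sum ≤ l.length * ρ := by
  induction l with
  | nil => simp
  | cons w l ih =>
    simp only [List.map_cons, List.sum_cons, List.length_cons, Nat.cast_succ]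
    have hw := h w (by simp)
    have ih' := ih (fun w' hw' => h w' (by simp [hw']))
    linarith

omit [IsIsometricSMul G G] in
/-- (1.20): the left member of (1.145) is `|(U′U₀)‾^j − Ū₀^j| = |(U′U₀)‾^j (Ū₀^j)⁻¹ − 1| = |Ũ′^j − 1|` for a
right-invariant distance. [cite: Balaban1985RegularSpaces, (1.20) p. 79] -/
theorem dist_mul_inv_one (x y : G) : dist (x * y⁻¹) 1 = dist x y := by
  simpa using dist_mul_right x y y⁻¹

omit [IsIsometricSMul Gᵐᵒᵖ G] in
/-- (b) the bound the displayed laws give on a crossing bond: `|Ũ′^j_b − 1| ≤ |F(b₋) − 1| + |exp iQ_{j,b} − 1|`.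
[folklore] -/
theorem LevelData.dist_crossing_le (X : LevelData S B G) {b : B} (hs : X.RuPrev (X.src b) = 1)
    (ht : X.Ru (X.tgt b) = 1) : dist (X.Uu b) 1 ≤ dist (X.F (X.src b)) 1 + dist (X.W b) 1 := by
  rw [X.crossing hs ht]; exact dist_mul_one_le _ _

/-- (b′) the same bound on a mirrored crossing bond: `|Ũ′^j_b − 1| ≤ |exp iQ_{j,b} − 1| + |F(b₊) − 1|`.
[folklore] -/
theorem LevelData.dist_crossing_mirrored_le (X : LevelData S B G) {b : B} (hs : X.Ru (X.src b) = 1)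
    (ht : X.RuPrev (X.tgt b) = 1) : dist (X.Uu b) 1 ≤ dist (X.W b) 1 + dist (X.F (X.tgt b)) 1 := by
  rw [X.crossing_mirrored hs ht]
  refine (dist_mul_one_le _ _).trans (le_of_eq ?_)
  rw [dist_rOp_one, dist_inv_one]

omit [IsIsometricSMul G G] [IsIsometricSMul Gᵐᵒᵖ G] in
/-- (c) on an interior bond the two members of (1.145) agree: `|Ũ′^j_b − 1| = |exp iQ_{j,b} − 1|`. [folklore] -/
theorem LevelData.dist_interior_eq (X : LevelData S B G) {b : B} (hs : X.Ru (X.src b) = 1)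
    (ht : X.Ru (X.tgt b) = 1) : dist (X.Uu b) 1 = dist (X.W b) 1 := by
  rw [X.interior hs ht]

/-! ## §3  The block factor: staircase count and the two constants -/

omit [IsIsometricSMul Gᵐᵒᵖ G] in
/-- The block-factor bound.  `Fy` is a block average (B7 (105)) of the transporters `T x`, `x ∈ B(y)`, that is
`κ`-Lipschitz at `1` (`havg`; `κ = 1` for the exp-mean-log of commuting or spectrally controlled factors, `κ` from
B7 (24)–(25)/(162) in general), and each transporter is a product of at most `n` (`= d(L−1)`) bond factors
`R̄^{j-1}_{0}(\bar\bar U₁^{j-1})_c`, each within `ρ` (`= 2α₂` by (1.143) at level `j−1` and `dist_rOp_one`) of `1`.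
Then `|F(y) − 1| ≤ κ·n·ρ`. [folklore] -/
theorem dist_blockFactor_le {Xs : Type*} (T : Xs → G) (Fy : G) {κ ρ : ℝ} {n : ℕ}
    (havg : ∀ s : ℝ, (∀ x, dist (T x) 1 ≤ s) → dist Fy 1 ≤ κ * s)
    (hT : ∀ x, ∃ l : List G, T x = l.prod ∧ l.length ≤ n ∧ ∀ w ∈ l, dist w 1 ≤ ρ) (hρ : 0 ≤ ρ) :
    dist Fy 1 ≤ κ * (n * ρ) := by
  apply havg
  intro x
  obtain ⟨l, hx, hlen, hw⟩ := hT x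
  rw [hx]
  refine (dist_list_prod_one_le l).trans ((sum_dist_le_length_mul l hw).trans ?_)
  exact mul_le_mul_of_nonneg_right (by exact_mod_cast hlen) hρ

omit [IsIsometricSMul Gᵐᵒᵖ G] in
/-- Crossing bond, assembled: `|Ũ′^j_b − 1| ≤ ρ + κ·n·ρ = (1 + κ n)·ρ`. [folklore] -/
theorem LevelData.dist_crossing_le_const (X : LevelData S B G) {b : B} (hs : X.RuPrev (X.src b) = 1)
    (ht : X.Ru (X.tgt b) = 1) {κ ρ : ℝ} {n : ℕ} (hW : dist (X.W b) 1 ≤ ρ)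
    (hF : dist (X.F (X.src b)) 1 ≤ κ * (n * ρ)) : dist (X.Uu b) 1 ≤ (1 + κ * n) * ρ := by
  have h := X.dist_crossing_le hs ht
  nlinarith

/-- The elementary constant: with `κ = 1`, `n = d(L−1)` staircase bonds and `ρ = 2α₂` one gets
`(1 + d(L−1))·2α₂ ≤ 2dL·α₂` for `d ≥ 1` — the mirror image of the paper's own forward constant `|B| < 2dLα₁` in
(1.37). [cite: Balaban1985RegularSpaces, (1.37) p. 82] -/
theorem const_count_le_2dL (d L α₂ : ℝ) (hd : 1 ≤ d) (hα : 0 ≤ α₂) :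
    (1 + 1 * (d * (L - 1))) * (2 * α₂) ≤ 2 * d * L * α₂ := by
  nlinarith [mul_nonneg (sub_nonneg.2 hd) hα]

/-- The published constant: B7 (162) bounds `|(1/i) log F| < 8dLα₂·e^{2dLα₂}` (B7's `α₁L^jη` is B8's `α₂`, the input
(161) being (1.143)), and `|F − 1| ≤ |log F|` (B7 (25), kernel-checked as `MatrixLog.norm_expUnitary_sub_one_le`);
so `|Ũ′^j_b − 1| < (2 + 8dL·E)α₂` with `E = e^{2dLα₂}`, which is `≤ 11dL·α₂` as soon as `E ≤ 9/8` and `dL ≥ 1`.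
[cite: Balaban1985Averaging, (162) p. 42] -/
theorem const_B7_162_le (d L α₂ E : ℝ) (hdL : 1 ≤ d * L) (hE : E ≤ 9 / 8) (hα : 0 ≤ α₂) :
    2 * α₂ + 8 * d * L * α₂ * E ≤ 11 * d * L * α₂ := by
  have h1 : 8 * d * L * α₂ * E ≤ 8 * d * L * α₂ * (9 / 8) :=
    mul_le_mul_of_nonneg_left hE (by nlinarith)
  nlinarith [mul_nonneg (by linarith : (0:ℝ) ≤ d * L - 1) hα]

end Metric

/-! ## §4  Tree bonds: (1.19)/(1.144) force `Ũ′^j_b = 1` -/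

section Tree

variable {G : Type*} [Group G]

/-- p. 79: «The conditions `(R₀V′)(Γ_{y,x}) = 1, x ∈ B(y)`, imply `V′_b = 1` for `b ⊂ Γ_{y,x}`».  Abstractly: the sites
`x` of a block tree rooted at `root` carry the contour products `P x = (R₀V′)(Γ_{y,x})`, built recursively from the
parent's product and the (conjugated) variable of the last bond (`hstep`); if all `P x = 1` ((1.19) with (1.20)),
every tree-bond variable is `1`. [cite: Balaban1985RegularSpaces, (1.19) p. 79] -/
theorem tree_bonds_trivial {Xs E : Type*} (root : Xs) (parent : Xs → Xs) (lastBond : Xs → E)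
    (t : Xs → G) (V : E → G) (P : Xs → G)
    (hstep : ∀ x, x ≠ root → P x = P (parent x) * rOp (t x) (V (lastBond x)))
    (h119 : ∀ x, P x = 1) : ∀ x, x ≠ root → V (lastBond x) = 1 := by
  intro x hx
  have h := hstep x hx
  rw [h119 x, h119 (parent x), one_mul] at h
  exact rOp_eq_one.1 h.symm

/-- (a) Hence on a tree bond with `Q_{j,b} ≠ 0` the EQUALITY of (1.145) fails: `|Ũ′^j_b − 1| = 0 ≠ |exp iQ_{j,b} − 1|`
(the inequality `0 < 2α₂` being trivially true). [folklore] -/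
theorem eq145_fails_of_trivial {M : Type*} [MetricSpace M] [One M] {Uu W : M} (hU : Uu = 1)
    (hW : W ≠ 1) : dist Uu 1 ≠ dist W 1 := by
  rw [hU, dist_self]
  exact fun h => hW (dist_eq_zero.1 h.symm)

end Tree

/-! ## §5  The flat abelian witness: arithmetic skeleton

Dictionary (hand computation recorded in the census row C-B8-30; not formalised here): `U₀ ≡ 1`, `A_b ≡ a·X` on
every fine bond (`X` a fixed unit element of a Cartan subalgebra, e.g. `X = 1 ∈ u(1)` or `σ₃ ∈ su(2)`), so all
variables commute and every exp-mean-log average is the exponential of the arithmetic mean of the logarithms.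
Then `\bar\bar U₁^n = exp(i L^nηa X)` on all `n`-bonds (the staircase legs of B7 (15) cancel pairwise; the two
`\overline{R_{0,·}U₁}` factors of (89) are equal by translation invariance and cancel), so `Q_n = L^nηa·X`,
(1.140) reads `L^nη|a| < α₂` (all derivatives of a constant field vanish) and (1.143) holds.  With the lower-corner
blocks of B7 (2) the contour `Γ_{y,x}`, `x ∈ B(y)`, has `n(x) = Σ_μ x_μ ∈ {0,…,d(L−1)}` level-`(j−1)` legs, so by
(105) `F(y) = exp(i · mean_x n(x) · L^{j-1}ηa · X) = exp(i·(d(L−1)/2)·L^{j-1}ηa·X)` (`stairMean_eq`), and on a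
top-level crossing bond (`j = k`, `b₋ ∈ Λ_{k-1}`, `b₊ ∈ Λ_k`; such bonds exist in every direction,
`B8ConstraintBonds.exists_classII_printed`) `Ũ′^k_b = exp(i·(d(L−1)/(2L) + 1)·L^kηa·X)`, whence
`|Ũ′^k_b − 1| = 2|sin(flatRatio d L · L^kηa / 2)|` against the printed `2α₂`. -/

section Flat

open Finset

/-- Mean number of level-`(j−1)` legs of the block contours `Γ_{y,x}`, `x ∈ B(y) = {0,…,L−1}^d` (lower-corner
blocks, B7 (2)): the average of `Σ_μ x_μ`. [cite: Balaban1985Averaging, (2) p. 17] -/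
noncomputable def stairMean (d L : ℕ) : ℝ :=
  (∑ x : Fin d → Fin L, ∑ μ : Fin d, ((x μ : ℕ) : ℝ)) / (L : ℝ) ^ d

/-- `2 Σ_{x ∈ {0..L-1}^d} x_μ = L^d (L − 1)`, by the reflection `x_μ ↦ L − 1 − x_μ`. [folklore] -/
theorem two_mul_sum_coord (d L : ℕ) (μ : Fin d) :
    2 * ∑ x : Fin d → Fin L, ((x μ : ℕ) : ℝ) = (L : ℝ) ^ d * ((L : ℝ) - 1) := by
  set e : (Fin d → Fin L) ≃ (Fin d → Fin L) := Equiv.piCongrRight fun _ => Fin.revPerm with he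
  have h1 : ∑ x : Fin d → Fin L, (((e x) μ : ℕ) : ℝ) = ∑ x : Fin d → Fin L, ((x μ : ℕ) : ℝ) :=
    Fintype.sum_equiv e (fun x => (((e x) μ : ℕ) : ℝ)) (fun x => ((x μ : ℕ) : ℝ)) fun _ => rfl
  have h2 : ∀ x : Fin d → Fin L, (((e x) μ : ℕ) : ℝ) = ((L : ℝ) - 1) - ((x μ : ℕ) : ℝ) := by
    intro x
    have hlt : (x μ : ℕ) + 1 ≤ L := (x μ).isLt
    have hv : ((e x) μ : ℕ) = L - ((x μ : ℕ) + 1) := by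
      rw [he]
      exact Fin.val_rev (x μ)
    rw [hv, Nat.cast_sub hlt]
    push_cast
    ring
  have h3 : ∑ x : Fin d → Fin L, (((e x) μ : ℕ) : ℝ) =
      ∑ _x : Fin d → Fin L, ((L : ℝ) - 1) - ∑ x : Fin d → Fin L, ((x μ : ℕ) : ℝ) := by
    rw [← Finset.sum_sub_distrib]
    exact Finset.sum_congr rfl fun x _ => h2 x
  simp only [Finset.sum_const, Finset.card_univ, Fintype.card_fun, Fintype.card_fin, nsmul_eq_mul,
    Nat.cast_pow] at h3
  linarith

/-- `stairMean d L = d(L−1)/2` (`L ≥ 1`). [folklore] -/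
theorem stairMean_eq (d L : ℕ) (hL : 0 < L) : stairMean d L = d * ((L : ℝ) - 1) / 2 := by
  have hLd : (0 : ℝ) < (L : ℝ) ^ d := by positivity
  have hμ : ∀ μ : Fin d, ∑ x : Fin d → Fin L, ((x μ : ℕ) : ℝ) = (L : ℝ) ^ d * ((L : ℝ) - 1) / 2 := by
    intro μ; linarith [two_mul_sum_coord d L μ]
  have hsum : ∑ x : Fin d → Fin L, ∑ μ : Fin d, ((x μ : ℕ) : ℝ) =
      d * ((L : ℝ) ^ d * ((L : ℝ) - 1) / 2) := by
    rw [Finset.sum_comm]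
    simp only [hμ, Finset.sum_const, Finset.card_univ, Fintype.card_fin, nsmul_eq_mul]
  unfold stairMean
  rw [hsum]
  field_simp

/-- The ratio `|log Ũ′^k_b| / |Q_{k,b}| = 1 + d(L−1)/(2L)` on a top-level crossing bond of the flat witness
(`log F = stairMean·L^{k-1}ηa`, `Q_k = L·L^{k-1}ηa`). [folklore] -/
noncomputable def flatRatio (d L : ℕ) : ℝ := 1 + d * ((L : ℝ) - 1) / (2 * L)

/-- `log Ũ′ = log F + Q = flatRatio · Q` in the flat witness (`q = L^{k-1}ηa`). [folklore] -/
theorem flat_log_identity (d L : ℕ) (hL : 0 < L) (q : ℝ) :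
    stairMean d L * q + L * q = flatRatio d L * (L * q) := by
  rw [stairMean_eq d L hL]
  unfold flatRatio
  have hL' : (L : ℝ) ≠ 0 := by exact_mod_cast hL.ne'
  field_simp
  ring

/-- The printed bound `2α₂` is beaten at first order iff `flatRatio > 2` iff `2L < d(L−1)`. [folklore] -/
theorem two_lt_flatRatio_iff (d L : ℕ) (hL : 0 < L) :
    2 < flatRatio d L ↔ 2 * (L : ℝ) < d * ((L : ℝ) - 1) := by
  unfold flatRatio
  have hL' : (0 : ℝ) < L := by exact_mod_cast hL
  rw [← one_lt_div (by linarith : (0 : ℝ) < 2 * L)]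
  constructor <;> intro h <;> linarith

/-- In `d = 4`: `flatRatio 4 L = 3 − 2/L`, `> 2` for every `L ≥ 3` (B12 takes `L > 11`); `= 2` at `L = 2`;
and `flatRatio d L ≤ 2` whenever `d ≤ 2`. [folklore] -/
theorem flatRatio_four (L : ℕ) (hL : 3 ≤ L) : 2 < flatRatio 4 L := by
  have hL' : (3 : ℝ) ≤ L := by exact_mod_cast hL
  rw [two_lt_flatRatio_iff 4 L (by omega)]
  push_cast
  linarith

/-- `flatRatio 4 3 = 7/3`. [folklore] -/
theorem flatRatio_four_three : flatRatio 4 3 = 7 / 3 := by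
  unfold flatRatio; norm_num

/-- `flatRatio 4 2 = 2`: at `L = 2` the flat witness does not beat `2α₂` at first order. [folklore] -/
theorem flatRatio_four_two : flatRatio 4 2 = 2 := by
  unfold flatRatio; norm_num

/-- `flatRatio d L ≤ 2` for `d ≤ 2`: in low dimension the flat witness never beats `2α₂`. [folklore] -/
theorem flatRatio_le_two_of_d_le_two (d L : ℕ) (hd : d ≤ 2) (hL : 0 < L) : flatRatio d L ≤ 2 := by
  unfold flatRatio
  have hL' : (1 : ℝ) ≤ L := by exact_mod_cast hL
  have hd' : (d : ℝ) ≤ 2 := by exact_mod_cast hd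
  have hd0 : (0 : ℝ) ≤ d := by exact_mod_cast Nat.zero_le d
  have h : (d : ℝ) * ((L : ℝ) - 1) / (2 * L) ≤ 1 := by
    rw [div_le_one (by linarith)]
    nlinarith
  linarith

/-- The witness beats the printed inequality, exactly (not only to first order): `d = 4`, `L = 3`,
`L^kηa = (27/28)α₂ < α₂` ((1.140) holds strictly, (1.143) holds), and `|Ũ′^k_b − 1| = 2 sin(flatRatio 4 3 ·
(27/28)α₂ / 2) = 2 sin((9/8)α₂) > 2α₂` for all `0 < α₂ ≤ 7/10`. [folklore] -/
theorem flat_witness_exceeds (α₂ : ℝ) (h0 : 0 < α₂) (h1 : α₂ ≤ 7 / 10) :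
    2 * α₂ < 2 * Real.sin (flatRatio 4 3 * ((27 / 28) * α₂) / 2) := by
  have harg : flatRatio 4 3 * ((27 / 28) * α₂) / 2 = 9 / 8 * α₂ := by
    rw [flatRatio_four_three]; ring
  rw [harg]
  have hx : 0 < 9 / 8 * α₂ := by positivity
  have hs := Real.sin_gt_sub_cube hx
  have hcube : (9 / 8 * α₂) ^ 3 / 6 ≤ 1 / 8 * α₂ := by
    have hsq : α₂ ^ 2 ≤ 49 / 100 := by nlinarith
    nlinarith [hsq, h0]
  linarith

end Flat

/-! ## §6  Proposition 7 repaired and its consumption by Theorem 2 -/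

section Prop7

variable {I : Type}

/-- Proposition 7 with (1.145) replaced by what pp. 81–82 and B7 (162) actually give and what Theorem 2 consumes:
(1.35) on `Λ_j` with `α₁ = C·α₂` (`C = C(d,L)`: `2 + 8dLe^{2dLc}` via B7 (162), or `2dL` by the staircase count),
printed hypothesis (1.140) (`C140`, pv17's `GFData3`), conclusion (1.144) verbatim.  `C = 2` is the typed printed
form `B8SectGH.Prop7PrintedR`. [cite: Balaban1985RegularSpaces, Prop. 7 p. 100 with (1.31) p. 82] -/
def Prop7RepairedC (C : ℝ) (fam : I → B8SectGH.GFData3)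
    (toAxial : ∀ i, (fam i).Cfg → (fam i).Pert → (fam i).Pert) : Prop :=
  ∃ c : ℝ, 0 < c ∧ ∀ i : I, ∀ α₀ α₂ : ℝ, 0 < α₀ → α₀ ≤ c → 0 < α₂ → α₂ ≤ c →
    ∀ U₀ : (fam i).Cfg, ∀ U₁ : (fam i).Pert, (fam i).InA α₀ U₀ → (fam i).C140 α₂ U₀ U₁ →
      (fam i).InAAx (α₀ + 3 * α₂) U₀ (toAxial i U₀ U₁) ∧
        (fam i).avgClose (C * α₂) U₀ (toAxial i U₀ U₁)

/-- The repair WEAKENS the printed statement: `Prop7PrintedR ⇒ Prop7RepairedC C` for every `C ≥ 2`, given the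
displayed monotonicity of (1.35) in its constant (`hmono`; true by unfolding in every honest instance). [folklore] -/
theorem prop7RepairedC_of_printedR (C : ℝ) (hC : 2 ≤ C) (fam : I → B8SectGH.GFData3)
    (toAxial : ∀ i, (fam i).Cfg → (fam i).Pert → (fam i).Pert)
    (hmono : ∀ i (a a' : ℝ) (U₀ : (fam i).Cfg) (U' : (fam i).Pert),
      a ≤ a' → (fam i).avgClose a U₀ U' → (fam i).avgClose a' U₀ U')
    (h : B8SectGH.Prop7PrintedR fam toAxial) : Prop7RepairedC C fam toAxial := by
  obtain ⟨c, hc, H⟩ := h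
  refine ⟨c, hc, fun i α₀ α₂ h₀ h₀c h₂ h₂c U₀ U₁ hA h140 => ?_⟩
  obtain ⟨hax, hcl⟩ := H i α₀ α₂ h₀ h₀c h₂ h₂c U₀ U₁ hA h140
  exact ⟨hax, hmono i _ _ U₀ _ (mul_le_mul_of_nonneg_right hC h₂.le) hcl⟩

/-- Monotonicity of the repaired statement in `C`. [folklore] -/
theorem prop7RepairedC_mono {C C' : ℝ} (hCC' : C ≤ C') (fam : I → B8SectGH.GFData3)
    (toAxial : ∀ i, (fam i).Cfg → (fam i).Pert → (fam i).Pert)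
    (hmono : ∀ i (a a' : ℝ) (U₀ : (fam i).Cfg) (U' : (fam i).Pert),
      a ≤ a' → (fam i).avgClose a U₀ U' → (fam i).avgClose a' U₀ U')
    (h : Prop7RepairedC C fam toAxial) : Prop7RepairedC C' fam toAxial := by
  obtain ⟨c, hc, H⟩ := h
  refine ⟨c, hc, fun i α₀ α₂ h₀ h₀c h₂ h₂c U₀ U₁ hA h140 => ?_⟩
  obtain ⟨hax, hcl⟩ := H i α₀ α₂ h₀ h₀c h₂ h₂c U₀ U₁ hA h140
  exact ⟨hax, hmono i _ _ U₀ _ (mul_le_mul_of_nonneg_right hCC' h₂.le) hcl⟩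

/-- CONSTANTS ONLY: the repaired Prop. 7 feeds the printed Theorem 2 (`B8.Thm2Printed`) exactly as the printed one
did, with `α₁ = Cα₂` in place of `2α₂` — the gauge-fixed `U′^u` satisfies (1.36)–(1.39) with `α₀ + 3α₂ + Cα₂`,
under the smallness `α₀ + (3 + C)α₂ ≤ c`.  Displayed laws: `𝔄_k(α)` increases with `α` (`hInA_mono`) and Prop. 6
(`hreg`, as in `B8.thm2_exists_without_reg335`). [cite: Balaban1985RegularSpaces, Thm 2 p. 82, Prop. 7 p. 100] -/
theorem thm2_after_prop7RepairedC (C : ℝ) (hC : 0 < C) (fam : I → B8SectGH.GFData3)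
    (toAxial : ∀ i, (fam i).Cfg → (fam i).Pert → (fam i).Pert)
    (h7 : Prop7RepairedC C fam toAxial)
    (h2 : B8.Thm2Printed (fun i => (fam i).toGFData))
    (hInA_mono : ∀ i (a a' : ℝ) (U₀ : (fam i).Cfg), a ≤ a' → (fam i).InA a U₀ → (fam i).InA a' U₀)
    (hreg : ∀ i (a : ℝ) (U₀ : (fam i).Cfg), (fam i).InA a U₀ → (fam i).Reg335 a U₀) :
    ∃ B₁ B₂ c : ℝ, 0 < B₁ ∧ 0 < B₂ ∧ 0 < c ∧
      ∀ i : I, ∀ α₀ α₂ : ℝ, 0 < α₀ → 0 < α₂ → α₀ + (3 + C) * α₂ ≤ c →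
        ∀ U₀ : (fam i).Cfg, ∀ U₁ : (fam i).Pert, (fam i).InA α₀ U₀ → (fam i).C140 α₂ U₀ U₁ →
          ∃ u : (fam i).GT, (fam i).Restricted U₀ u ∧
            (fam i).C136 B₁ B₂ (α₀ + 3 * α₂ + C * α₂) U₀ ((fam i).act (toAxial i U₀ U₁) u) ∧
            (fam i).C137 (C * α₂) U₀ ((fam i).act (toAxial i U₀ U₁) u) ∧
            (fam i).Landau U₀ ((fam i).act (toAxial i U₀ U₁) u) ∧
            (fam i).C139 B₁ (α₀ + 3 * α₂ + C * α₂) U₀ ((fam i).act (toAxial i U₀ U₁) u) := by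
  obtain ⟨c₇, hc₇, H7⟩ := h7
  obtain ⟨B₁, B₂, c₁, hB₁, hB₂, hc₁, H2⟩ := h2
  refine ⟨B₁, B₂, min c₇ c₁, hB₁, hB₂, lt_min hc₇ hc₁, ?_⟩
  intro i α₀ α₂ h₀ h₂ hsum U₀ U₁ hA h140
  have hc7 : min c₇ c₁ ≤ c₇ := min_le_left _ _
  have hc1 : min c₇ c₁ ≤ c₁ := min_le_right _ _
  have h₀c : α₀ ≤ c₇ := by nlinarith
  have h₂c : α₂ ≤ c₇ := by nlinarith
  obtain ⟨hax, hcl⟩ := H7 i α₀ α₂ h₀ h₀c h₂ h₂c U₀ U₁ hA h140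
  have hα₀' : 0 < α₀ + 3 * α₂ := by positivity
  have hα₁ : 0 < C * α₂ := by positivity
  have hle : α₀ + 3 * α₂ + C * α₂ ≤ c₁ := by nlinarith
  have hmono₀ : α₀ ≤ α₀ + 3 * α₂ := by linarith
  obtain ⟨u, hres, hprops, -⟩ := H2 i (α₀ + 3 * α₂) (C * α₂) hα₀' hα₁ hle U₀ (toAxial i U₀ U₁)
    (hInA_mono i _ _ U₀ hmono₀ hA) (hreg i _ U₀ (hInA_mono i _ _ U₀ hmono₀ hA)) hax hcl
  exact ⟨u, hres, hprops⟩

end Prop7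

end Literature.MathematicalPhysics.QuantumFieldTheory.Balaban1983to89.B8Ineq145
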